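import Mathlib
import Summits.CriticalPhenomena.CardyFormulaZ2.Theorems.CardyMagicRigidityNestingRigidityTreeRigidityFamilySwitchConfigs
import HarnessLib

/-!
# Stub `stub_treeRigidity`: the needle `[1, 2]` and slit discs (family-switch witness, part 2)

Crux `Summit.CriticalPhenomena.CardyFormulaZ2.Theses.CardyMagicRigidity.NestingRigidity`
(stmt-CriticalPhenomena-4835), line `positive-cone-weight-doubling`, registered stub `stub_treeRigidity`.
Elementary geometry of the law-level route-gap witness `…TreeRigidityFamilySwitch` (continuation of
`…TreeRigidityFamilySwitchConfigs`, p129094):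

* §1 the needle `ν = segment ℝ 1 2 ⊆ ℂ`: membership (`mem_needle_iff`: real part in `[1, 2]`, imaginary
  part `0`), closedness, empty interior, and the closed discs `B̄(c, ρ)` (`c` real) containing it;
  `frontier_ball_sdiff_needle` (registered anchor) — the SLIT DISC `B(c, ρ) ∖ ν` has frontier
  `sphere c ρ ∪ ν`: a circle loop with the needle retraced inside has trace = frontier of its winding
  interior, i.e. passes `Regular.boundary`;
* §2 `interior_of_lobe`, `interior_of_needled` — winding interiors and covering degrees of loops with the
  winding functions delivered by `exists_lobeLoop` / `exists_needledLobeLoop` (`…TreeRigidityNeedleLoops`);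
* §3 `volume_setOf_apply_ite_lt_half` — the two-piece volume formula of `…FamilySwitchConfigs` for an
  event read through a predicate.
-/

noncomputable section

open MeasureTheory Set Filter Metric
open scoped Real Topology BigOperators ENNReal

namespace Summit.CriticalPhenomena.CardyFormulaZ2.Cruxes.NestingRigidity.PositiveConeWeightDoubling

open Literature.Probability.RandomPlanarGeometry

namespace FamilySwitch

/-! ## §1 The needle `ν = [1, 2]` -/

/-- Points of the needle: real numbers between `1` and `2`. -/
theorem mem_needle_iff {z : ℂ} : z ∈ segment ℝ (1 : ℂ) 2 ↔ z.im = 0 ∧ 1 ≤ z.re ∧ z.re ≤ 2 := by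
  rw [segment_eq_image']
  constructor
  · rintro ⟨θ, hθ, rfl⟩
    simp only [Complex.real_smul, Complex.add_im, Complex.one_im, Complex.mul_im, Complex.ofReal_re,
      Complex.sub_im, Complex.ofReal_im, Complex.sub_re, Complex.add_re, Complex.one_re, Complex.mul_re]
    norm_num
    exact ⟨hθ.1, by linarith [hθ.2]⟩
  · rintro ⟨him, h1, h2⟩
    refine ⟨z.re - 1, ⟨by linarith, by linarith⟩, Complex.ext ?_ ?_⟩
    · simp [Complex.real_smul]; norm_num
    · simp [Complex.real_smul, him]

/-- The needle is closed. -/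
theorem isClosed_needle : IsClosed (segment ℝ (1 : ℂ) 2) := by
  have : segment ℝ (1 : ℂ) 2 = Complex.im ⁻¹' {0} ∩ Complex.re ⁻¹' Icc 1 2 := by
    ext z; simp [mem_needle_iff]
  rw [this]
  exact ((isClosed_singleton).preimage Complex.continuous_im).inter
    (isClosed_Icc.preimage Complex.continuous_re)

/-- The needle has empty interior (it lies on the real axis). -/
theorem interior_needle : interior (segment ℝ (1 : ℂ) 2) = ∅ := by
  refine Set.eq_empty_of_forall_notMem fun z hz ↦ ?_
  obtain ⟨ε, hε, hball⟩ := Metric.isOpen_iff.1 isOpen_interior z hz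
  have hmem : z + (ε / 2 : ℝ) * Complex.I ∈ segment ℝ (1 : ℂ) 2 := by
    refine interior_subset (hball ?_)
    rw [mem_ball, dist_eq_norm, add_sub_cancel_left, norm_mul, Complex.norm_real, Complex.norm_I,
      mul_one, Real.norm_eq_abs, abs_of_pos (by positivity)]
    linarith
  have h0 := (mem_needle_iff.1 (interior_subset hz)).1
  have h1 := (mem_needle_iff.1 hmem).1
  simp [h0] at h1
  exact hε.ne' h1

/-- The needle lies in every closed disc `B̄(c, ρ)`, `c` real, with `c − ρ ≤ 1` and `2 ≤ c + ρ`. -/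
theorem needle_subset_closedBall {c ρ : ℝ} (h1 : c - ρ ≤ 1) (h2 : 2 ≤ c + ρ) :
    segment ℝ (1 : ℂ) 2 ⊆ closedBall (c : ℂ) ρ := by
  intro z hz
  obtain ⟨him, hz1, hz2⟩ := mem_needle_iff.1 hz
  have hz' : z - c = ((z.re - c : ℝ) : ℂ) := Complex.ext (by simp) (by simp [him])
  rw [mem_closedBall, dist_eq_norm, hz', Complex.norm_real, Real.norm_eq_abs, abs_le]
  constructor <;> linarith

/-- Norms of needle points are at most `2`. -/
theorem needle_subset_closedBall_zero : segment ℝ (1 : ℂ) 2 ⊆ closedBall (0 : ℂ) 2 := by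
  simpa using needle_subset_closedBall (c := 0) (ρ := 2) (by norm_num) (by norm_num)

end FamilySwitch

open FamilySwitch in
/-- **Slit discs along the needle have frontier circle ∪ needle (registered anchor).**  For a real centre
`c` and a radius `ρ > 0` with `[1, 2] ⊆ [c − ρ, c + ρ]`, the open disc `B(c, ρ)` slit along the needle
`ν = [1, 2]` has frontier `sphere c ρ ∪ ν` — so a circle loop followed by the needle retraced inside the
disc (winding interior `B(c, ρ) ∖ ν`, trace `sphere c ρ ∪ ν`) has the boundary property of `Regular`. -/
theorem frontier_ball_sdiff_needle : ∀ (c ρ : ℝ), 0 < ρ → c - ρ ≤ 1 → 2 ≤ c + ρ →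
    frontier (Metric.ball (c : ℂ) ρ \ segment ℝ (1 : ℂ) 2) = Metric.sphere (c : ℂ) ρ ∪ segment ℝ (1 : ℂ) 2 :=
  fun _ _ hρ h1 h2 ↦ frontier_ball_diff hρ isClosed_needle interior_needle (needle_subset_closedBall h1 h2)

namespace FamilySwitch

/-! ## §2 Loops given by a (needled) disc: interiors and degree -/

/-- Interior and degree of a loop with the winding function of a circle lobe. -/
theorem interior_of_lobe {u : UnbasedLoop ℂ} {c : ℂ} {ρ : ℝ} (h1 : ∀ z, dist z c < ρ → u.wind z = 1)
    (h0 : ∀ z, ρ ≤ dist z c → u.wind z = 0) :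
    {z | u.wind z ≠ 0} = ball c ρ ∧ ∀ z, u.wind z = 0 ∨ u.wind z = 1 := by
  refine ⟨Set.ext fun z ↦ ?_, fun z ↦ ?_⟩
  · by_cases hz : dist z c < ρ
    · simp [h1 z hz, mem_ball.2 hz]
    · simp [h0 z (not_lt.1 hz), hz]
  · by_cases hz : dist z c < ρ
    exacts [Or.inr (h1 z hz), Or.inl (h0 z (not_lt.1 hz))]

/-- Interior and degree of a loop with the winding function of a needled circle lobe. -/
theorem interior_of_needled {u : UnbasedLoop ℂ} {c : ℂ} {ρ : ℝ} {ν : Set ℂ} (hν : ∀ z ∈ ν, u.wind z = 0)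
    (h1 : ∀ z, z ∉ ν → dist z c < ρ → u.wind z = 1) (h0 : ∀ z, z ∉ ν → ρ ≤ dist z c → u.wind z = 0) :
    {z | u.wind z ≠ 0} = ball c ρ \ ν ∧ ∀ z, u.wind z = 0 ∨ u.wind z = 1 := by
  refine ⟨Set.ext fun z ↦ ?_, fun z ↦ ?_⟩
  · by_cases hzν : z ∈ ν
    · simp [hν z hzν, hzν]
    by_cases hz : dist z c < ρ
    · simp [h1 z hzν hz, mem_ball.2 hz, hzν]
    · simp [h0 z hzν (not_lt.1 hz), hz]
  · by_cases hzν : z ∈ ν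
    · exact Or.inl (hν z hzν)
    by_cases hz : dist z c < ρ
    exacts [Or.inr (h1 z hzν hz), Or.inl (h0 z hzν (not_lt.1 hz))]

end FamilySwitch

/-! ## §3 Two-piece events read through a predicate -/

/-- **Volume of a two-piece event on `([0,1], Leb)`, predicate form**: for a predicate `P` and two
values `f`, `g`, the set of `s` with `P (if s < 1/2 then f else g)` has measure `𝟙[P f]/2 + 𝟙[P g]/2`. -/
theorem volume_setOf_apply_ite_lt_half {β : Type*} (P : β → Prop) [DecidablePred P] (f g : β) :
    volume {s : unitInterval | P (if s < ⟨1 / 2, half_mem_unitInterval⟩ then f else g)} =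
      (if P f then ENNReal.ofReal (1 / 2) else 0) + (if P g then ENNReal.ofReal (1 / 2) else 0) := by
  rw [← volume_setOf_ite_lt_half]
  congr 1
  exact Set.ext fun s ↦ by simp only [mem_setOf_eq]; split_ifs <;> exact Iff.rfl

end Summit.CriticalPhenomena.CardyFormulaZ2.Cruxes.NestingRigidity.PositiveConeWeightDoubling

end
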